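import Literature.NumberTheory.NumberFields.RayClassFieldLocalLiftAllLevels
import Literature.NumberTheory.NumberFields.RayClassFieldTwoVariableLayerApproximation
import Literature.NumberTheory.NumberFields.RayClassFieldLocalTowerNormUnramified
import Literature.NumberTheory.NumberFields.RayClassFieldArtinSymbolSurjective
import Literature.NumberTheory.NumberFields.RayClassFieldAdicCharacterDecomposition
import HarnessLib

/-!
# THE DECOMPOSITION GROUP IN THE TWO-VARIABLE TOWER `K(𝔤v'^{i+1}v^{k+1})` IS OPEN, AND THE INDEX SET OF THE
# ELLIPTIC-UNIT PRODUCT RULE: every `g ∈ Γ_K` fixing `K(𝔤v'v^{k+1})` is LOCAL on every layer, and the ideals whose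
# Artin symbols lift to `Γ_{K_v}` at all levels form a multiplicative system meeting every local class
# (de Shalit II.1.10 / II.4.12 / II.4.14: `σ_𝔞` runs over the decomposition group `D`; Neukirch VI (5.6), (7.1))

Setting of `RayClassFieldTwoVariableLayerApproximation` (number field `K` totally complex, place `v`, auxiliary
prime `v' ≠ v`, `v ∤ 𝔤 ≠ 0`, `w_{𝔤v'} = 1`, a uniformiser `π` of `K_v` with `α_i = π^{f_i} ≡ 1 mod 𝔤v'^{i+1}`, a
monotone local unramified tower `E_j ≤ K_v^{nr}` with the global level `i` at the local level `i + c`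
(`hdegE : f_i ∣ deg w` on `Γ_{E_{i+c}}`), the INERT hypothesis (`Γ_{K_v}`-fixers of `ι K(𝔤v'^{i+1})` fix
`E_{i+c}`, all `i ≥ 0` — the form of `RayClassFieldTwoVariableLayerApproximation`) and the COUNT
(`[K(𝔤v'^{i+2}v^{k+1}) : K(𝔤v'^{i+1}v^{k+1})]·[E_{i+c}:K_v] ≤ [E_{i+1+c}:K_v]`) — the local binders of the (c)-capstone for the
elliptic units (`Summit…ColemanCoinvariantEllipticUnits.charIdeal_coinvariants_colemanImage_closure_ellipticUnits_eq_span`; its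
`hinert` is the shift `i ↦ i + 1` of the one here).  Under these
hypotheses the prime `𝔓` of `K(𝔤v'v^{k+1})` under `ι : K̄ → K̄_v` has ONE prime above it in the whole tower — the
decomposition group is open — and this file proves the consequences the capstone's input (G) asks for:

* ★ `exists_local_absRestrictNormalHom_rayClassField₂_eq` — **every `g ∈ Γ_K` fixing `K(𝔤v'^{i₀+1}v^{k+1})` pointwise is,
  on `K(𝔤v'^{n+1}v^{k+1})` (`n ≥ i₀`), the restriction of an element of `Γ_{K_v}`** ((SURJ) from (INJ) by counting:
  `RayClassFieldLocalTowerNormUnramified.exists_absRestrictNormalHom_eq_of_card_le` with `M = E_{n+c}·K_π^{k+1}`);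
* ★ `exists_local_forall_absRestrictNormalHom_rayClassField₂_eq` — the same partner can be taken to agree with `g` on
  EVERY `K(𝔤v'^{n+1}v^{k'})` (inertia supply `exists_mem_inertia_forall_absRestrictNormalHom_eq`: `𝔓` is totally
  ramified in the `v`-direction);
* ★★ `exists_ideal_forall_exists_local_artinSymbol_eq` — **for every `τ ∈ Γ_{K_v}` and `N` there is an integral `𝔞 ≠ 0`
  prime to `𝔤vv'` whose Artin symbol lifts to `Γ_{K_v}` at EVERY diagonal level `K(𝔤v'^{n+1}v^{n+1})` and equals
  `res τ` on `K(𝔤v'^{N+1}v^{N+1})`** (Artin surjectivity with integral representatives + the global Artin element of `𝔞`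
  + the two results above);
* `IsLocArtinLiftable 𝔤 v v' 𝔞` (one `Prop`-valued definition) — the index set `{𝔞 : (𝔞, K(𝔤v'^∞v^∞)/K) ∈ D_𝔓}` read
  level-wise; `IsLocArtinLiftable.mul` (a multiplicative system); ★★ `exists_localLift_of_isLocArtinLiftable` (ONE
  `σ̃_𝔞 ∈ Γ_{K_v}` for all levels `(i, k)` — `RayClassFieldLocalLiftAllLevels`); ★★★ **`happrox_of_isLocArtinLiftable`** —
  the capstone's layer-approximation (G) for ANY family of such lifts, via
  `RayClassFieldTwoVariableLayerApproximation.happrox_of_artinSymbol_layers`.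

One `Prop`-valued definition (`IsLocArtinLiftable`); theorems otherwise; no `sorry`; no instances.

## References
* [deShalit1987] E. de Shalit, *Iwasawa theory of elliptic curves with complex multiplication* (1987), II.1.10 Lemma and
  Corollary (p. 39), II.4.12 (p. 66–68: `σ_𝔞 ∈ D`), II.4.14 (p. 71), III.1.1–1.3.
* [NeukirchANT1999] J. Neukirch, *Algebraic Number Theory* (1999), Ch. VI §5 Prop. (5.6), §7 Thm. (7.1), Cor. (7.3);
  Ch. IV §1 (1.2).
-/

noncomputable section

open NumberField IsDedekindDomain IsDedekindDomain.HeightOneSpectrum Field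
open scoped nonZeroDivisors Classical

namespace Literature.NumberTheory.NumberFields

open Literature.NumberTheory.GaloisRepresentations
open Literature.NumberTheory.GaloisRepresentations.IsNonarchimedeanLocalField
open Literature.NumberTheory.LFunctions.AbelianDensity (artinSymbol)
open ValuativeRel

variable {K : Type} [Field K] [NumberField K] {𝔤 : Ideal (𝓞 K)} {v v' : HeightOneSpectrum (𝓞 K)}

/-! ### §0. Restrictions and moduli (bookkeeping) -/

omit [NumberField K] in
/-- `((τ|_L) x : K̄) = τ • x`. [folklore] -/
private theorem coe_absRestrictNormalHom_apply₁₅ (L : IntermediateField K (AlgebraicClosure K)) [Normal K L]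
    (τ : absoluteGaloisGroup K) (x : L) :
    ((absRestrictNormalHom L τ x : L) : AlgebraicClosure K) = τ • (x : AlgebraicClosure K) :=
  AlgEquiv.restrictNormalHom_apply L _ x

omit [NumberField K] in
/-- `res_L ρ = res_L ρ'` iff `ρ`, `ρ'` agree on `L` pointwise. [folklore] -/
private theorem absRestrictNormalHom_eq_iff_forall_smul_eq₁₅ (L : IntermediateField K (AlgebraicClosure K)) [Normal K L]
    (ρ ρ' : absoluteGaloisGroup K) :
    absRestrictNormalHom L ρ = absRestrictNormalHom L ρ' ↔ ∀ x ∈ L, ρ • x = ρ' • x := by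
  constructor
  · intro h x hx
    have e := congrArg (fun σ : L ≃ₐ[K] L ↦ ((σ ⟨x, hx⟩ : L) : AlgebraicClosure K)) h
    simpa only [coe_absRestrictNormalHom_apply₁₅] using e
  · intro h
    ext x
    rw [coe_absRestrictNormalHom_apply₁₅, coe_absRestrictNormalHom_apply₁₅]
    exact h x x.2

omit [NumberField K] in
/-- Agreement on `L'` restricts to agreement on `L ≤ L'`. [folklore] -/
private theorem absRestrictNormalHom_eq_of_le₁₅ {L L' : IntermediateField K (AlgebraicClosure K)} [Normal K L] [Normal K L']
    (hLL' : L ≤ L') {ρ ρ' : absoluteGaloisGroup K} (h : absRestrictNormalHom L' ρ = absRestrictNormalHom L' ρ') :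
    absRestrictNormalHom L ρ = absRestrictNormalHom L ρ' :=
  (absRestrictNormalHom_eq_iff_forall_smul_eq₁₅ L ρ ρ').mpr fun x hx ↦
    (absRestrictNormalHom_eq_iff_forall_smul_eq₁₅ L' ρ ρ').mp h x (hLL' hx)

omit [NumberField K] in
/-- `𝔤v'^{i+1}v^{k} ≠ 0`. [cite: deShalit1987, II.4.14 (p. 71)] -/
private theorem moduli₂_ne_bot₁₅ (h𝔤0 : 𝔤 ≠ ⊥) (i k : ℕ) : 𝔤 * v'.asIdeal ^ (i + 1) * v.asIdeal ^ k ≠ ⊥ :=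
  mul_ne_zero (mul_ne_zero h𝔤0 (pow_ne_zero _ v'.ne_bot)) (pow_ne_zero _ v.ne_bot)

omit [NumberField K] in
/-- `𝔤v'^{i+1} ≠ 0`. [cite: deShalit1987, II.4.14 (p. 71)] -/
private theorem moduli_ne_bot₁₅ (h𝔤0 : 𝔤 ≠ ⊥) (i : ℕ) : 𝔤 * v'.asIdeal ^ (i + 1) ≠ ⊥ :=
  mul_ne_zero h𝔤0 (pow_ne_zero _ v'.ne_bot)

/-- `v ∤ 𝔤v'^{i+1}`. [cite: deShalit1987, II.4.14 (p. 71)] -/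
private theorem not_moduli_le₁₅ (hv : ¬ 𝔤 ≤ v.asIdeal) (hvv' : v' ≠ v) (i : ℕ) : ¬ 𝔤 * v'.asIdeal ^ (i + 1) ≤ v.asIdeal := by
  intro h
  rcases (v.isPrime.mul_le).mp h with h1 | h2
  · exact hv h1
  · exact hvv' (HeightOneSpectrum.ext ((v'.isMaximal.eq_of_le v.isPrime.ne_top ((Ideal.IsPrime.pow_le_iff (hP := v.isPrime)
      (Nat.succ_ne_zero i)).mp h2))))

omit [NumberField K] in
/-- `w_{𝔤v'} = 1 ⟹ w_{𝔤v'^{i+1}} = 1`. [cite: deShalit1987, II.4.14 (p. 71)] -/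
private theorem hw_moduli₁₅ (hw : ∀ u : (𝓞 K)ˣ, (u : 𝓞 K) - 1 ∈ 𝔤 * v'.asIdeal → u = 1) (i : ℕ) :
    ∀ u : (𝓞 K)ˣ, (u : 𝓞 K) - 1 ∈ 𝔤 * v'.asIdeal ^ (i + 1) → u = 1 :=
  fun u hu ↦ hw u (Ideal.mul_mono_right (by rw [pow_succ]; exact Ideal.mul_le_left) hu)

/-- `K(𝔤v'^{i+1}v^{k}) ≤ K(𝔤v'^{n+1}v^{k'})` for `i ≤ n`, `k ≤ k'`. [cite: deShalit1987, II.4.14 (p. 71)] -/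
private theorem rayClassField₂_le₁₅ (h𝔤0 : 𝔤 ≠ ⊥) {i n k k' : ℕ} (hin : i ≤ n) (hk : k ≤ k') :
    rayClassField K (𝔤 * v'.asIdeal ^ (i + 1) * v.asIdeal ^ k) ≤ rayClassField K (𝔤 * v'.asIdeal ^ (n + 1) * v.asIdeal ^ k') :=
  rayClassField_le_of_le (moduli₂_ne_bot₁₅ h𝔤0 n k')
    (Ideal.mul_mono (Ideal.mul_mono_right (Ideal.pow_le_pow_right (Nat.succ_le_succ hin))) (Ideal.pow_le_pow_right hk))

variable [IsTotallyComplex K]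
  (h𝔤0 : 𝔤 ≠ ⊥) (hv : ¬ 𝔤 ≤ v.asIdeal) (hvv' : v' ≠ v) (hw : ∀ u : (𝓞 K)ˣ, (u : 𝓞 K) - 1 ∈ 𝔤 * v'.asIdeal → u = 1)
  {π : 𝒪[v.adicCompletion K]} (hπ : (valuation (v.adicCompletion K)).IsUniformizer (π : v.adicCompletion K))
  {α : ℕ → 𝓞 K} (hα0 : ∀ i, α i ≠ 0) (hα𝔪 : ∀ i, α i - 1 ∈ 𝔤 * v'.asIdeal ^ (i + 1))
  (hαw : ∀ i, ∀ w : HeightOneSpectrum (𝓞 K), w ≠ v → α i ∉ w.asIdeal)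
  {f : ℕ → ℕ} (hαπ : ∀ i, ((α i : K) : v.adicCompletion K) = (π : v.adicCompletion K) ^ f i)
  (E : ℕ → IntermediateField (v.adicCompletion K) (AlgebraicClosure (v.adicCompletion K)))
  [∀ j, FiniteDimensional (v.adicCompletion K) (E j)] [∀ j, IsGalois (v.adicCompletion K) (E j)]
  (hmono : Monotone E) (hE : ∀ j, E j ≤ maxUnramified (v.adicCompletion K)) (c : ℕ)
  (hdegE : ∀ i, ∀ w : WeilGroup (v.adicCompletion K),
    WeilGroup.toAbsGalois (v.adicCompletion K) w ∈ (E (i + c)).fixingSubgroup → (f i : ℤ) ∣ WeilGroup.deg w)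
  (hinert : ∀ i, ∀ τ : absoluteGaloisGroup (v.adicCompletion K),
    (∀ y ∈ rayClassField K (𝔤 * v'.asIdeal ^ (i + 1)),
      τ • absClosureEmbedding K (v.adicCompletion K) y = absClosureEmbedding K (v.adicCompletion K) y) →
      τ ∈ (E (i + c)).fixingSubgroup)
  (hcount : ∀ i k : ℕ, IntermediateField.relfinrank (rayClassField K (𝔤 * v'.asIdeal ^ (i + 1) * v.asIdeal ^ (k + 1)))
      (rayClassField K (𝔤 * v'.asIdeal ^ (i + 1 + 1) * v.asIdeal ^ (k + 1))) * Module.finrank (v.adicCompletion K) (E (i + c)) ≤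
      Module.finrank (v.adicCompletion K) (E (i + 1 + c)))

/-! ### §1. The cumulative count `[K(𝔤v'^{n+1}v^{k+1}) : K(𝔤v'^{i₀+1}v^{k+1})]·[E_{i₀+c}:K_v] ≤ [E_{n+c}:K_v]` -/

omit [IsTotallyComplex K] [∀ j, FiniteDimensional (v.adicCompletion K) (E j)] [∀ j, IsGalois (v.adicCompletion K) (E j)] in
include h𝔤0 hcount in
/-- **The step counts multiply**: `[K(𝔤v'^{n+1}v^{k+1}) : K(𝔤v'^{i₀+1}v^{k+1})]·[E_{i₀+c}:K_v] ≤ [E_{n+c}:K_v]` for `i₀ ≤ n`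
(tower law for `relfinrank` and the step hypothesis `hcount`). [cite: deShalit1987, II.4.14 (p. 71)] [cite: NeukirchANT1999, Ch. IV §1 (1.2)] -/
theorem relfinrank_rayClassField₂_mul_finrank_le (k : ℕ) {i₀ n : ℕ} (hn : i₀ ≤ n) :
    IntermediateField.relfinrank (rayClassField K (𝔤 * v'.asIdeal ^ (i₀ + 1) * v.asIdeal ^ (k + 1)))
        (rayClassField K (𝔤 * v'.asIdeal ^ (n + 1) * v.asIdeal ^ (k + 1))) * Module.finrank (v.adicCompletion K) (E (i₀ + c)) ≤
      Module.finrank (v.adicCompletion K) (E (n + c)) := by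
  induction n, hn using Nat.le_induction with
  | base => rw [IntermediateField.relfinrank_self, one_mul]
  | succ n hn ih =>
    have h1 : rayClassField K (𝔤 * v'.asIdeal ^ (i₀ + 1) * v.asIdeal ^ (k + 1)) ≤
        rayClassField K (𝔤 * v'.asIdeal ^ (n + 1) * v.asIdeal ^ (k + 1)) := rayClassField₂_le₁₅ h𝔤0 hn le_rfl
    have h2 : rayClassField K (𝔤 * v'.asIdeal ^ (n + 1) * v.asIdeal ^ (k + 1)) ≤
        rayClassField K (𝔤 * v'.asIdeal ^ (n + 1 + 1) * v.asIdeal ^ (k + 1)) := rayClassField₂_le₁₅ h𝔤0 (Nat.le_succ n) le_rfl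
    rw [← IntermediateField.relfinrank_mul_relfinrank h1 h2]
    have hs := hcount n k
    calc IntermediateField.relfinrank (rayClassField K (𝔤 * v'.asIdeal ^ (i₀ + 1) * v.asIdeal ^ (k + 1)))
            (rayClassField K (𝔤 * v'.asIdeal ^ (n + 1) * v.asIdeal ^ (k + 1))) *
          IntermediateField.relfinrank (rayClassField K (𝔤 * v'.asIdeal ^ (n + 1) * v.asIdeal ^ (k + 1)))
            (rayClassField K (𝔤 * v'.asIdeal ^ (n + 1 + 1) * v.asIdeal ^ (k + 1))) *
          Module.finrank (v.adicCompletion K) (E (i₀ + c))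
        = IntermediateField.relfinrank (rayClassField K (𝔤 * v'.asIdeal ^ (n + 1) * v.asIdeal ^ (k + 1)))
            (rayClassField K (𝔤 * v'.asIdeal ^ (n + 1 + 1) * v.asIdeal ^ (k + 1))) *
          (IntermediateField.relfinrank (rayClassField K (𝔤 * v'.asIdeal ^ (i₀ + 1) * v.asIdeal ^ (k + 1)))
            (rayClassField K (𝔤 * v'.asIdeal ^ (n + 1) * v.asIdeal ^ (k + 1))) *
            Module.finrank (v.adicCompletion K) (E (i₀ + c))) := by ring
      _ ≤ IntermediateField.relfinrank (rayClassField K (𝔤 * v'.asIdeal ^ (n + 1) * v.asIdeal ^ (k + 1)))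
            (rayClassField K (𝔤 * v'.asIdeal ^ (n + 1 + 1) * v.asIdeal ^ (k + 1))) *
          Module.finrank (v.adicCompletion K) (E (n + c)) := Nat.mul_le_mul_left _ ih
      _ ≤ Module.finrank (v.adicCompletion K) (E (n + 1 + c)) := hs

/-! ### §2. (SURJ): every `g ∈ Γ_K` fixing `K(𝔤v'^{i₀+1}v^{k+1})` is local on `K(𝔤v'^{n+1}v^{k+1})` -/

include h𝔤0 hv hvv' hπ hα0 hα𝔪 hαw hαπ hmono hE hdegE hinert hcount in
/-- ★ **(SURJ) — every element of `Gal(K(𝔤v'^{n+1}v^{k+1})/K(𝔤v'^{i₀+1}v^{k+1}))` is the restriction of a LOCAL element**: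
for `i₀ ≤ n` and `g ∈ Γ_K` fixing `K(𝔤v'^{i₀+1}v^{k+1})` pointwise there is `ρ ∈ Γ_{K_v}` with
`res ρ|_{K(𝔤v'^{n+1}v^{k+1})} = g|_{K(𝔤v'^{n+1}v^{k+1})}` — i.e. the prime of `K(𝔤v'^{i₀+1}v^{k+1})` under `ι` does not split
further in `K(𝔤v'^{n+1}v^{k+1})` (the decomposition group is open).  Proof: (SURJ) from (INJ) by counting
(`exists_absRestrictNormalHom_eq_of_card_le`) with `M₀ = E_{i₀+c}·K_π^{k+1} ≤ M = E_{n+c}·K_π^{k+1}`: `ι K(·) ⊆ M`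
(`absClosureEmbedding_mem_sup_ltField_of_mem_rayClassField_mul_pow`), (INJ) = INERT, and the count of §1.
[cite: deShalit1987, II.1.10 Corollary (p. 39), II.4.12 (p. 66), II.4.14 (p. 71)] [cite: NeukirchANT1999, Ch. VI §5 Prop. (5.6), Ch. IV §1 (1.2)] -/
theorem exists_local_absRestrictNormalHom_rayClassField₂_eq (k : ℕ) {i₀ n : ℕ} (hn : i₀ ≤ n) (g : absoluteGaloisGroup K)
    (hg : ∀ y ∈ rayClassField K (𝔤 * v'.asIdeal ^ (i₀ + 1) * v.asIdeal ^ (k + 1)), g • y = y) :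
    ∃ ρ : absoluteGaloisGroup (v.adicCompletion K),
      absRestrictNormalHom (rayClassField K (𝔤 * v'.asIdeal ^ (n + 1) * v.asIdeal ^ (k + 1)))
          (absGaloisRestrict K (v.adicCompletion K) ρ) =
        absRestrictNormalHom (rayClassField K (𝔤 * v'.asIdeal ^ (n + 1) * v.asIdeal ^ (k + 1))) g := by
  haveI : CharZero (v.adicCompletion K) := charZero_of_injective_algebraMap (algebraMap K (v.adicCompletion K)).injective
  haveI : FiniteDimensional (v.adicCompletion K)
      (E (n + c) ⊔ ltField π k : IntermediateField (v.adicCompletion K) (AlgebraicClosure (v.adicCompletion K))) :=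
    IntermediateField.finiteDimensional_sup (E (n + c)) (ltField π k)
  haveI : IsGalois (v.adicCompletion K)
      (E (n + c) ⊔ ltField π k : IntermediateField (v.adicCompletion K) (AlgebraicClosure (v.adicCompletion K))) :=
    isGalois_sup_ltField hπ (E (n + c)) k
  haveI : FiniteDimensional (v.adicCompletion K)
      (E (i₀ + c) ⊔ ltField π k : IntermediateField (v.adicCompletion K) (AlgebraicClosure (v.adicCompletion K))) :=
    IntermediateField.finiteDimensional_sup (E (i₀ + c)) (ltField π k)
  have hLle : rayClassField K (𝔤 * v'.asIdeal ^ (i₀ + 1) * v.asIdeal ^ (k + 1)) ≤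
      rayClassField K (𝔤 * v'.asIdeal ^ (n + 1) * v.asIdeal ^ (k + 1)) := rayClassField₂_le₁₅ h𝔤0 hn le_rfl
  have hMle : (E (i₀ + c) ⊔ ltField π k : IntermediateField (v.adicCompletion K) (AlgebraicClosure (v.adicCompletion K))) ≤
      E (n + c) ⊔ ltField π k := sup_le_sup_right (hmono (by omega)) (ltField π k)
  refine (exists_absRestrictNormalHom_eq_of_card_le
    (rayClassField K (𝔤 * v'.asIdeal ^ (i₀ + 1) * v.asIdeal ^ (k + 1)))
    (rayClassField K (𝔤 * v'.asIdeal ^ (n + 1) * v.asIdeal ^ (k + 1))) hLle (E (i₀ + c) ⊔ ltField π k) (E (n + c) ⊔ ltField π k) hMle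
    (fun y hy ↦ absClosureEmbedding_mem_sup_ltField_of_mem_rayClassField_mul_pow (moduli_ne_bot₁₅ h𝔤0 n) (not_moduli_le₁₅ hv hvv' n)
      hπ (hα0 n) (hα𝔪 n) (hαw n) (hαπ n) (E (n + c)) (hdegE n) k hy)
    (fun y hy ↦ absClosureEmbedding_mem_sup_ltField_of_mem_rayClassField_mul_pow (moduli_ne_bot₁₅ h𝔤0 i₀) (not_moduli_le₁₅ hv hvv' i₀)
      hπ (hα0 i₀) (hα𝔪 i₀) (hαw i₀) (hαπ i₀) (E (i₀ + c)) (hdegE i₀) k hy)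
    (fun τ hτ₀ hτfix ↦ ?_) ?_ (absRestrictNormalHom (rayClassField K (𝔤 * v'.asIdeal ^ (n + 1) * v.asIdeal ^ (k + 1))) g)
    (fun y hy ↦ by rw [coe_absRestrictNormalHom_apply₁₅]; exact hg _ hy)).imp fun ρ h ↦ h.1
  · -- (INJ): `τ` fixes `K_π^{k+1}` (inside `M₀`) and `E_{n+c}` (INERT: it fixes `ι K(𝔤v'^{n+1}) ⊆ ι K(𝔤v'^{n+1}v^{k+1})`)
    rw [IntermediateField.fixingSubgroup_sup]
    exact ⟨hinert n τ fun y hy ↦ hτfix y (rayClassField_le_of_le (moduli₂_ne_bot₁₅ h𝔤0 n (k + 1)) Ideal.mul_le_right hy),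
      IntermediateField.fixingSubgroup_antitone le_sup_right hτ₀⟩
  · -- (COUNT): `#Gal(L/L₀)·[L₀:K] = [L:K]`, `#Gal(M/M₀)·[M₀:K_v] = [M:K_v] = [E_{n+c}:K_v][K_π^{k+1}:K_v]`
    have hcL := card_filter_fixing_mul_finrank (F := K) hLle
    have hcM := card_filter_fixing_mul_finrank (F := v.adicCompletion K) hMle
    rw [finrank_sup_ltField_of_le_maxUnramified hπ (E (i₀ + c)) (hE (i₀ + c)) k,
      finrank_sup_ltField_of_le_maxUnramified hπ (E (n + c)) (hE (n + c)) k] at hcM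
    have hrel := IntermediateField.finrank_bot_mul_relfinrank hLle
    have hcum := relfinrank_rayClassField₂_mul_finrank_le h𝔤0 E c hcount k hn
    set cL := (Finset.univ.filter (fun ρ : (rayClassField K (𝔤 * v'.asIdeal ^ (n + 1) * v.asIdeal ^ (k + 1))) ≃ₐ[K]
        (rayClassField K (𝔤 * v'.asIdeal ^ (n + 1) * v.asIdeal ^ (k + 1))) =>
        ∀ y : rayClassField K (𝔤 * v'.asIdeal ^ (i₀ + 1) * v.asIdeal ^ (k + 1)),
          ρ (IntermediateField.inclusion hLle y) = IntermediateField.inclusion hLle y)).card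
    set cM := (Finset.univ.filter (fun σ : (E (n + c) ⊔ ltField π k : IntermediateField (v.adicCompletion K)
        (AlgebraicClosure (v.adicCompletion K))) ≃ₐ[v.adicCompletion K]
        (E (n + c) ⊔ ltField π k : IntermediateField (v.adicCompletion K) (AlgebraicClosure (v.adicCompletion K))) =>
        ∀ y : (E (i₀ + c) ⊔ ltField π k : IntermediateField (v.adicCompletion K) (AlgebraicClosure (v.adicCompletion K))),
          σ (IntermediateField.inclusion hMle y) = IntermediateField.inclusion hMle y)).card
    have hL0 : 0 < Module.finrank K (rayClassField K (𝔤 * v'.asIdeal ^ (i₀ + 1) * v.asIdeal ^ (k + 1))) := Module.finrank_pos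
    have hE0 : 0 < Module.finrank (v.adicCompletion K) (E (i₀ + c)) := Module.finrank_pos
    have hπ0 : 0 < Module.finrank (v.adicCompletion K) (ltField π k) := Module.finrank_pos
    -- `cL = relfinrank L₀ L`
    have hcL' : cL = IntermediateField.relfinrank (rayClassField K (𝔤 * v'.asIdeal ^ (i₀ + 1) * v.asIdeal ^ (k + 1)))
        (rayClassField K (𝔤 * v'.asIdeal ^ (n + 1) * v.asIdeal ^ (k + 1))) := by
      apply Nat.eq_of_mul_eq_mul_left hL0
      rw [hrel, ← hcL, mul_comm]
    -- `cM * [E_{i₀+c}:K_v] = [E_{n+c}:K_v]`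
    have hcM' : cM * Module.finrank (v.adicCompletion K) (E (i₀ + c)) = Module.finrank (v.adicCompletion K) (E (n + c)) := by
      apply Nat.eq_of_mul_eq_mul_right hπ0
      rw [mul_assoc, hcM]
    calc cL = cL * Module.finrank (v.adicCompletion K) (E (i₀ + c)) / Module.finrank (v.adicCompletion K) (E (i₀ + c)) :=
          (Nat.mul_div_cancel cL hE0).symm
      _ ≤ Module.finrank (v.adicCompletion K) (E (n + c)) / Module.finrank (v.adicCompletion K) (E (i₀ + c)) :=
          Nat.div_le_div_right (by rw [hcL']; exact hcum)
      _ = cM := by rw [← hcM', Nat.mul_div_cancel cM hE0]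

/-! ### §3. … and can be taken to agree with `g` on the whole `v`-tower `K(𝔤v'^{n+1}v^{k'})` -/

include h𝔤0 hv hvv' hw hπ hα0 hα𝔪 hαw hαπ hmono hE hdegE hinert hcount in
/-- ★ **A local partner on the whole `v`-tower over the level `n`**: for `i₀ ≤ n` and `g ∈ Γ_K` fixing `K(𝔤v'^{i₀+1}v^{k+1})`
pointwise there is `τ' ∈ Γ_{K_v}` with `res τ'|_{K(𝔤v'^{n+1}v^{k'})} = g|_{K(𝔤v'^{n+1}v^{k'})}` for EVERY `k'` (§2 gives `ρ`
on `K(𝔤v'^{n+1}v^{k+1})`; `ρ⁻¹g` fixes `K(𝔤v'^{n+1})`, so acts on the `v`-tower `K(𝔤v'^{n+1}v^∞)` as a local INERTIA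
element `w` — `exists_mem_inertia_forall_absRestrictNormalHom_eq`, `𝔓` totally ramified; `τ' = ρ·w`).
[cite: deShalit1987, II.1.10 Corollary (p. 39), II.4.12 (p. 66)] [cite: NeukirchANT1999, Ch. VI §5 Prop. (5.6)] -/
theorem exists_local_forall_absRestrictNormalHom_rayClassField₂_eq (k : ℕ) {i₀ n : ℕ} (hn : i₀ ≤ n) (g : absoluteGaloisGroup K)
    (hg : ∀ y ∈ rayClassField K (𝔤 * v'.asIdeal ^ (i₀ + 1) * v.asIdeal ^ (k + 1)), g • y = y) :
    ∃ τ' : absoluteGaloisGroup (v.adicCompletion K), ∀ k' : ℕ,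
      absRestrictNormalHom (rayClassField K (𝔤 * v'.asIdeal ^ (n + 1) * v.asIdeal ^ k'))
          (absGaloisRestrict K (v.adicCompletion K) τ') =
        absRestrictNormalHom (rayClassField K (𝔤 * v'.asIdeal ^ (n + 1) * v.asIdeal ^ k')) g := by
  obtain ⟨ρ, hρ⟩ := exists_local_absRestrictNormalHom_rayClassField₂_eq h𝔤0 hv hvv' hπ hα0 hα𝔪 hαw hαπ E hmono hE c hdegE hinert
    hcount k hn g hg
  have ha := isLocalArtinMap_canonicalArtin_holds (v.adicCompletion K)
  -- `ρ⁻¹g` fixes `K(𝔤v'^{n+1}) ≤ K(𝔤v'^{n+1}v^{k+1})`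
  have hg' : (absGaloisRestrict K (v.adicCompletion K) ρ)⁻¹ * g ∈
      (absRestrictNormalHom (rayClassField K (𝔤 * v'.asIdeal ^ (n + 1)))).ker := by
    rw [MonoidHom.mem_ker, map_mul, map_inv, inv_mul_eq_one]
    have hle : rayClassField K (𝔤 * v'.asIdeal ^ (n + 1)) ≤ rayClassField K (𝔤 * v'.asIdeal ^ (n + 1) * v.asIdeal ^ (k + 1)) :=
      rayClassField_le_of_le (moduli₂_ne_bot₁₅ h𝔤0 n (k + 1)) Ideal.mul_le_right
    exact absRestrictNormalHom_eq_of_le₁₅ hle hρ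
  obtain ⟨w, -, -, hw'⟩ := exists_mem_inertia_forall_absRestrictNormalHom_eq (moduli_ne_bot₁₅ h𝔤0 n) (not_moduli_le₁₅ hv hvv' n)
    (hw_moduli₁₅ hw n) ha ⟨_, hg'⟩
  refine ⟨ρ * WeilGroup.toAbsGalois (v.adicCompletion K) w, fun k' ↦ ?_⟩
  rw [map_mul, map_mul, hw' k', map_mul, map_inv, mul_inv_cancel_left]

/-! ### §4. The index set: ideals whose Artin symbols lift locally at every diagonal level -/

include h𝔤0 hv hvv' hw hπ hα0 hα𝔪 hαw hαπ hmono hE hdegE hinert hcount in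
/-- ★★ **Every local class is met by a liftable ideal**: for `τ ∈ Γ_{K_v}` and `N` there is an integral ideal `𝔞 ≠ 0` prime
to `𝔤vv'` such that (a) at EVERY diagonal level `K(𝔤v'^{n+1}v^{n+1})` the Artin symbol `(𝔞, ·/K)` is the restriction of
some element of `Γ_{K_v}`, and (b) `(𝔞, K(𝔤v'^{N+1}v^{N+1})/K) = res τ|`.  (Artin surjectivity with integral representatives
`exists_ideal_artinSymbol_eq_absRestrictNormalHom` at level `N`; the global Artin element `g_𝔞`
(`exists_forall_absRestrictNormalHom_eq_artinHom`); `τ⁻¹g_𝔞` fixes `K(𝔤v'^{N+1}v^{N+1}) ⊇ K(𝔤v'v^{N+1})`, so §3 supplies a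
local partner on every `K(𝔤v'^{n+1}v^{n+1})`.)  This is de Shalit's "`σ_𝔞 ∈ D`" index set being large enough.
[cite: deShalit1987, II.4.12 (p. 66–68), II.4.14 (p. 71)] [cite: NeukirchANT1999, Ch. VI §7 Thm. (7.1), §5 Prop. (5.6)] -/
theorem exists_ideal_forall_exists_local_artinSymbol_eq (τ : absoluteGaloisGroup (v.adicCompletion K)) (N : ℕ) :
    ∃ 𝔞 : Ideal (𝓞 K), 𝔞 ≠ ⊥ ∧ IsCoprime 𝔞 (𝔤 * v.asIdeal * v'.asIdeal) ∧
      (∀ n : ℕ, ∃ τ' : absoluteGaloisGroup (v.adicCompletion K),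
        absRestrictNormalHom (rayClassField K (𝔤 * v'.asIdeal ^ (n + 1) * v.asIdeal ^ (n + 1)))
            (absGaloisRestrict K (v.adicCompletion K) τ') =
          artinSymbol (galFrob K (rayClassField K (𝔤 * v'.asIdeal ^ (n + 1) * v.asIdeal ^ (n + 1)))) 𝔞) ∧
      artinSymbol (galFrob K (rayClassField K (𝔤 * v'.asIdeal ^ (N + 1) * v.asIdeal ^ (N + 1)))) 𝔞 =
        absRestrictNormalHom (rayClassField K (𝔤 * v'.asIdeal ^ (N + 1) * v.asIdeal ^ (N + 1)))
          (absGaloisRestrict K (v.adicCompletion K) τ) := by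
  have hN0 := moduli₂_ne_bot₁₅ (v := v) (v' := v') h𝔤0 N (N + 1)
  obtain ⟨𝔞, h𝔞0, h𝔞c, h𝔞⟩ := exists_ideal_artinSymbol_eq_absRestrictNormalHom hN0 (absGaloisRestrict K (v.adicCompletion K) τ)
  -- `𝔞` is prime to `𝔤vv'`
  have hcop : IsCoprime 𝔞 (𝔤 * v.asIdeal * v'.asIdeal) :=
    (h𝔞c.of_mul_right_left.of_mul_right_left.mul_right ((IsCoprime.pow_right_iff (Nat.succ_pos N)).mp h𝔞c.of_mul_right_right)).mul_right
      ((IsCoprime.pow_right_iff (Nat.succ_pos N)).mp h𝔞c.of_mul_right_left.of_mul_right_right)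
  have hcopn : ∀ i k : ℕ, IsCoprime 𝔞 (𝔤 * v'.asIdeal ^ (i + 1) * v.asIdeal ^ k) := fun i k ↦
    ((hcop.of_mul_right_left.of_mul_right_left).mul_right (hcop.of_mul_right_right.pow_right)).mul_right
      (hcop.of_mul_right_left.of_mul_right_right.pow_right)
  -- the global Artin element of `𝔞`
  obtain ⟨g, hg⟩ := exists_forall_absRestrictNormalHom_eq_artinHom (K := K)
    (Units.mk0 (𝔞 : FractionalIdeal (𝓞 K)⁰ K) (coeIdeal_ne_zero_of_ne_bot h𝔞0))
  have hg' : ∀ i k : ℕ, absRestrictNormalHom (rayClassField K (𝔤 * v'.asIdeal ^ (i + 1) * v.asIdeal ^ k)) g =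
      artinSymbol (galFrob K (rayClassField K (𝔤 * v'.asIdeal ^ (i + 1) * v.asIdeal ^ k))) 𝔞 := fun i k ↦ by
    rw [hg _ (moduli₂_ne_bot₁₅ h𝔤0 i k) (unitsMk0_coeIdeal_mem_idealsPrimeTo (moduli₂_ne_bot₁₅ h𝔤0 i k) h𝔞0 (hcopn i k)),
      artinHom_unitsMk0_coeIdeal _ h𝔞0]
  refine ⟨𝔞, h𝔞0, hcop, fun n ↦ ?_, h𝔞⟩
  -- `τ⁻¹ g` fixes `K(𝔤v'v^{N+1}) ≤ K(𝔤v'^{N+1}v^{N+1})` pointwise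
  have hfix : ∀ y ∈ rayClassField K (𝔤 * v'.asIdeal ^ ((0 : ℕ) + 1) * v.asIdeal ^ (N + 1)),
      ((absGaloisRestrict K (v.adicCompletion K) τ)⁻¹ * g) • y = y := by
    have hle : rayClassField K (𝔤 * v'.asIdeal ^ ((0 : ℕ) + 1) * v.asIdeal ^ (N + 1)) ≤
        rayClassField K (𝔤 * v'.asIdeal ^ (N + 1) * v.asIdeal ^ (N + 1)) := rayClassField₂_le₁₅ h𝔤0 (Nat.zero_le N) le_rfl
    have e : absRestrictNormalHom (rayClassField K (𝔤 * v'.asIdeal ^ ((0 : ℕ) + 1) * v.asIdeal ^ (N + 1)))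
        ((absGaloisRestrict K (v.adicCompletion K) τ)⁻¹ * g) =
        absRestrictNormalHom (rayClassField K (𝔤 * v'.asIdeal ^ ((0 : ℕ) + 1) * v.asIdeal ^ (N + 1))) 1 := by
      rw [map_mul, map_inv, map_one, inv_mul_eq_one]
      exact absRestrictNormalHom_eq_of_le₁₅ hle (h𝔞.symm.trans (hg' N (N + 1)).symm)
    intro y hy
    have h1 := (absRestrictNormalHom_eq_iff_forall_smul_eq₁₅ _ _ _).mp e y hy
    rwa [one_smul] at h1
  obtain ⟨τ', hτ'⟩ := exists_local_forall_absRestrictNormalHom_rayClassField₂_eq h𝔤0 hv hvv' hw hπ hα0 hα𝔪 hαw hαπ E hmono hE c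
    hdegE hinert hcount N (Nat.zero_le n) _ hfix
  refine ⟨τ * τ', ?_⟩
  rw [map_mul, map_mul, hτ' (n + 1), map_mul, map_inv, mul_inv_cancel_left, hg' n (n + 1)]

/-- **The index set of the two-variable product rule**: an integral ideal `𝔞 ≠ 0` prime to `𝔤vv'` whose Artin symbol
`(𝔞, K(𝔤v'^{n+1}v^{n+1})/K)` is, at EVERY diagonal level, the restriction of an element of `Γ_{K_v}` along
`ι : K̄ → K̄_v` — de Shalit's `σ_𝔞 ∈ D` (the decomposition group of `𝔓` in `Gal(K(𝔤v'^∞v^∞)/K)`), read on the finite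
layers. [cite: deShalit1987, II.4.12 (p. 66–68), II.4.14 (p. 71)] -/
def IsLocArtinLiftable (𝔤 : Ideal (𝓞 K)) (v v' : HeightOneSpectrum (𝓞 K)) (𝔞 : Ideal (𝓞 K)) : Prop :=
  𝔞 ≠ ⊥ ∧ IsCoprime 𝔞 (𝔤 * v.asIdeal * v'.asIdeal) ∧
    ∀ n : ℕ, ∃ τ' : absoluteGaloisGroup (v.adicCompletion K),
      absRestrictNormalHom (rayClassField K (𝔤 * v'.asIdeal ^ (n + 1) * v.asIdeal ^ (n + 1)))
          (absGaloisRestrict K (v.adicCompletion K) τ') =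
        artinSymbol (galFrob K (rayClassField K (𝔤 * v'.asIdeal ^ (n + 1) * v.asIdeal ^ (n + 1)))) 𝔞

omit [IsTotallyComplex K] in
/-- `IsLocArtinLiftable` is closed under products (Artin symbols and restrictions are multiplicative).
[cite: deShalit1987, II.4.12 (p. 66)] [cite: NeukirchANT1999, Ch. VI §7 Thm. (7.1)] -/
theorem IsLocArtinLiftable.mul {𝔞 𝔟 : Ideal (𝓞 K)} (h𝔞 : IsLocArtinLiftable 𝔤 v v' 𝔞) (h𝔟 : IsLocArtinLiftable 𝔤 v v' 𝔟) :
    IsLocArtinLiftable 𝔤 v v' (𝔞 * 𝔟) := by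
  refine ⟨mul_ne_zero h𝔞.1 h𝔟.1, h𝔞.2.1.mul_left h𝔟.2.1, fun n ↦ ?_⟩
  obtain ⟨τ₁, h₁⟩ := h𝔞.2.2 n
  obtain ⟨τ₂, h₂⟩ := h𝔟.2.2 n
  refine ⟨τ₁ * τ₂, ?_⟩
  rw [map_mul, map_mul, h₁, h₂, LFunctions.AbelianDensity.artinSymbol_mul _ h𝔞.1 h𝔟.1]

include h𝔤0 hv hvv' hw hπ hα0 hα𝔪 hαw hαπ hmono hE hdegE hinert hcount in
/-- ★★ **Every local class is met by the index set**: for `τ ∈ Γ_{K_v}` and `N` some `𝔞` with `IsLocArtinLiftable 𝔤 v v' 𝔞` has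
`(𝔞, K(𝔤v'^{N+1}v^{N+1})/K) = res τ|`. [cite: deShalit1987, II.4.12 (p. 66–68), II.4.14 (p. 71)] [cite: NeukirchANT1999, Ch. VI §7 Thm. (7.1)] -/
theorem exists_isLocArtinLiftable_artinSymbol_eq (τ : absoluteGaloisGroup (v.adicCompletion K)) (N : ℕ) :
    ∃ 𝔞 : Ideal (𝓞 K), IsLocArtinLiftable 𝔤 v v' 𝔞 ∧
      artinSymbol (galFrob K (rayClassField K (𝔤 * v'.asIdeal ^ (N + 1) * v.asIdeal ^ (N + 1)))) 𝔞 =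
        absRestrictNormalHom (rayClassField K (𝔤 * v'.asIdeal ^ (N + 1) * v.asIdeal ^ (N + 1)))
          (absGaloisRestrict K (v.adicCompletion K) τ) := by
  obtain ⟨𝔞, h0, hc, hl, hN⟩ := exists_ideal_forall_exists_local_artinSymbol_eq h𝔤0 hv hvv' hw hπ hα0 hα𝔪 hαw hαπ E hmono hE c
    hdegE hinert hcount τ N
  exact ⟨𝔞, ⟨h0, hc, hl⟩, hN⟩

omit [IsTotallyComplex K] in
include h𝔤0 in
/-- ★★ **ONE local lift `σ̃_𝔞 ∈ Γ_{K_v}` at ALL levels `(i, k)`** for every liftable `𝔞` (compactness: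
`RayClassFieldLocalLiftAllLevels.exists_forall₂_absRestrictNormalHom_eq_artinSymbol`), as a family over the index type
`{𝔞 // IsLocArtinLiftable 𝔤 v v' 𝔞}` — the hypothesis `hσ` of the (c)-capstone for the elliptic units.
[cite: deShalit1987, II.4.12 (p. 66), II.4.14 (p. 71)] [cite: NeukirchANT1999, Ch. VI §5 Prop. (5.6)] -/
theorem exists_localLift_of_isLocArtinLiftable :
    ∃ σ : {𝔞 : Ideal (𝓞 K) // IsLocArtinLiftable 𝔤 v v' 𝔞} → absoluteGaloisGroup (v.adicCompletion K),
      ∀ a, ∀ i k : ℕ, absRestrictNormalHom (rayClassField K (𝔤 * v'.asIdeal ^ (i + 1) * v.asIdeal ^ (k + 1)))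
          (absGaloisRestrict K (v.adicCompletion K) (σ a)) =
        artinSymbol (galFrob K (rayClassField K (𝔤 * v'.asIdeal ^ (i + 1) * v.asIdeal ^ (k + 1)))) (a.1 : Ideal (𝓞 K)) := by
  have key : ∀ a : {𝔞 : Ideal (𝓞 K) // IsLocArtinLiftable 𝔤 v v' 𝔞}, ∃ σ : absoluteGaloisGroup (v.adicCompletion K),
      ∀ i k : ℕ, absRestrictNormalHom (rayClassField K (𝔤 * v'.asIdeal ^ (i + 1) * v.asIdeal ^ (k + 1)))
          (absGaloisRestrict K (v.adicCompletion K) σ) =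
        artinSymbol (galFrob K (rayClassField K (𝔤 * v'.asIdeal ^ (i + 1) * v.asIdeal ^ (k + 1)))) (a.1 : Ideal (𝓞 K)) :=
    fun a ↦ exists_forall₂_absRestrictNormalHom_eq_artinSymbol h𝔤0 v v' a.2.1 a.2.2.1 a.2.2.2
  exact ⟨fun a ↦ Classical.choose (key a), fun a ↦ Classical.choose_spec (key a)⟩

include h𝔤0 hv hvv' hw hπ hα0 hα𝔪 hαw hαπ hmono hE hdegE hinert hcount in
/-- ★★★ **INPUT (G) OF THE (c)-CAPSTONE — the layer-approximation by the Artin lifts of the liftable ideals**: for ANY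
family `σ̃_a ∈ Γ_{K_v}` of local lifts of the Artin symbols of the liftable ideals (`res σ̃_a| = (𝔞_a, K(𝔤v'^{i+1}v^{k+1})/K)`
for all `i, k`), every `τ ∈ Γ_{K_v}` agrees with some `σ̃_a` on every local layer `E_N·K_π^{N+1}` — the hypothesis
`happrox` of `Summit…ColemanCoinvariantArtin.charIdeal_coinvariants_colemanImage_closure_eq_span_of_mul_rule` /
`…ColemanCoinvariantEllipticUnits…`, DISCHARGED from the local tower data alone (the decomposition group is open and the
Artin symbols of integral ideals fill every finite layer). [cite: deShalit1987, II.1.10 (p. 39), II.4.12 (p. 66–68), II.4.14 (p. 71)]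
[cite: NeukirchANT1999, Ch. VI §5 Prop. (5.6), §7 Thm. (7.1)] -/
theorem happrox_of_isLocArtinLiftable
    (σ : {𝔞 : Ideal (𝓞 K) // IsLocArtinLiftable 𝔤 v v' 𝔞} → absoluteGaloisGroup (v.adicCompletion K))
    (hσ : ∀ a, ∀ i k : ℕ, absRestrictNormalHom (rayClassField K (𝔤 * v'.asIdeal ^ (i + 1) * v.asIdeal ^ (k + 1)))
        (absGaloisRestrict K (v.adicCompletion K) (σ a)) =
      artinSymbol (galFrob K (rayClassField K (𝔤 * v'.asIdeal ^ (i + 1) * v.asIdeal ^ (k + 1)))) (a.1 : Ideal (𝓞 K)))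
    (τ : absoluteGaloisGroup (v.adicCompletion K)) (N : ℕ) :
    ∃ a : {𝔞 : Ideal (𝓞 K) // IsLocArtinLiftable 𝔤 v v' 𝔞},
      ∀ z : (E N ⊔ ltField π N : IntermediateField (v.adicCompletion K) (AlgebraicClosure (v.adicCompletion K))),
        σ a • (z : AlgebraicClosure (v.adicCompletion K)) = τ • (z : AlgebraicClosure (v.adicCompletion K)) := by
  refine happrox_of_artinSymbol_layers h𝔤0 hv hvv' hw hπ hα0 hα𝔪 hαw hαπ E hmono c hdegE hinert σ (fun N' τ' ↦ ?_) τ N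
  obtain ⟨𝔞, h𝔞, hN'⟩ := exists_isLocArtinLiftable_artinSymbol_eq h𝔤0 hv hvv' hw hπ hα0 hα𝔪 hαw hαπ E hmono hE c hdegE hinert hcount
    τ' N'
  exact ⟨⟨𝔞, h𝔞⟩, (hσ ⟨𝔞, h𝔞⟩ N' N').trans hN'⟩

end Literature.NumberTheory.NumberFields

end
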